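import Summits.Ventures.HSemireg.WedgeHankelRecurrenceLienardChipartCoefficients

/-!
# Venture HSemireg — THE HERMITE–BIEHLER THEOREM IN POSITIVE-PAIR FORM: a real `p = f(X²) + X g(X²)` with positive leading coefficient is a Hurwitz polynomial **iff** (even degree) `f` splits
# over `ℝ` with simple NEGATIVE roots `x` at which `g(x)·f′(x) > 0`; (odd degree) `g` splits over `ℝ` with simple NEGATIVE roots `y` at which `f(y)·g′(y) < 0`, and `f(0)·g(0) > 0`

HONEST FRAMING. Part of the Lean index of the computation cell `pub-hsemireg` (seat p10 gen 38, Sunday typer «UNIFORM-IN-n»).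
REAL POLYNOMIALS AND REAL SYMMETRIC MATRICES ONLY: no variety, no cohomology theory, no sheaf, no Ext group and no semiregularity map is constructed here; nothing here says that HC / HC_CM /
HC_AV holds; no Literature fact (unproved `Prop`) is declared or used.  Custodian versions as in `WedgeHankelSiegelIdeal` (1/3).
SOURCE (cited; held text read, `paper:arxiv-math_0512591` = O. Holtz, Hermite–Biehler, Routh–Hurwitz, and total positivity, LAA 372 (2003), §2 chunk p0004): **Theorem 1** (Hermite–Biehler)
«Let `f(x) = p(x²) + xq(x²)` … The following are equivalent. A. The polynomial `f` is stable. B. The polynomials `p(−x²)` and `xq(−x²)` have simple real interlacing roots and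
`Re p(z₀²)/(z₀q(z₀²)) > 0` for some `z₀` with `Re z₀ > 0`», with the remark in the proof of Thm 2: «Condition B … is equivalent to `p` and `q` satisfying `p(0)q(0) > 0` and having only simple
zeros, all negative, interlacing, the rightmost zero being that of `p`.»  DICTIONARY: `(p, q)` = our `(f, g)`.
READING NOTE (what is typed): «simple real zeros, all negative, interlacing with orientation» is rendered by the tree's POSITIVE-PAIR condition (N152/N201): the denominator splits over `ℝ`
with simple roots, all negative, and the numerator times the derivative of the denominator is positive at each of them (for consecutive simple roots the derivative alternates, so the
numerator alternates: this IS strict interlacing with the printed orientation — that equivalence with the word «interlacing» is NOT typed here; no interlacing predicate exists in the tree).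
PROOF ROUTE: N189 (`Hurwitz ⟺ B(f, Xg) ≻ 0 ∧ B(g, f) ≻ 0`) + N201 `posDef_bezoutian_iff_splits_separable_forall_pos` on both Bezoutians, merged root by root (`x < 0 ∧ t > 0 ⟺ t > 0 ∧ (−x)t > 0`).
DEDUP DISCLOSURE (`rg` of the whole tree + Mathlib, 2026-09-02): no Hermite–Biehler statement in Literature ∕ Summits ∕ Mathlib; N201 §891 is the positive-pair criterion for ONE Bezoutian; the
merged stability criteria below are new.  7 names: 0 hits tree-wide + Mathlib.

WHAT IS IN THE TREE.  N189 `forall_re_neg_iff_posDef_bezoutian_and_of_even ∕ …_of_odd`; N190 `natDegree_even_add_odd_of_lt_left`, `natDegree_even_add_odd_of_le_right`; N201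
`posDef_bezoutian_iff_splits_separable_forall_pos`, `coeff_even_eq`, `coeff_odd_eq`; Literature `Bezoutian`: `bezoutian_swap`, `bezoutian_smul_left`.  Mathlib: `Splits.X`, `Splits.mul`, `Splits.of_dvd`,
`Separable.mul`, `Separable.of_mul_right`, `Irreducible.coprime_iff_not_dvd`, `X_dvd_iff`, `roots_mul`, `roots_X`.
THIS FILE (namespace `Summit.Ventures.HSemireg.Wedge.HankelOuter` continued; CHAINED on N201; 0 definitions):
* §899 EVEN DEGREE `2m + 2` (`deg f = m + 1`, `deg g ≤ m`, `lc f > 0`): `posDef_bezoutian_pair_iff_of_even` (the two Bezoutian conditions ⟺ the positive-pair data), `leadingCoeff_even_add_odd_of_even`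
  (`lc p = lc f`), **`forall_re_neg_iff_hermiteBiehler_of_even`**.
* §900 ODD DEGREE `2m + 3` (`deg g = m + 1`, `deg f ≤ m + 1`, `lc g > 0`): `splits_separable_X_mul_iff` (`X·g` splits with simple roots ⟺ `g` does and `g(0) ≠ 0`),
  `leadingCoeff_even_add_odd_of_odd` (`lc p = lc g`), `posDef_bezoutian_pair_iff_of_odd`, **`forall_re_neg_iff_hermiteBiehler_of_odd`**.
CAVEATS.  `lc > 0` is assumed (for `lc < 0` apply the statements to `−p`); the interlacing vocabulary itself is not formalised (READING NOTE).  Nothing Ext-side.  New names only.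
-/

open Module Polynomial
open scoped Matrix Polynomial

namespace Summit.Ventures.HSemireg.Wedge.HankelOuter

open Summit.Ventures.HSemireg.Wedge Summit.Ventures.HSemireg.Wedge.Hankel
open Literature.LinearAlgebra.Matrix.Bezoutian (bezCoeff bezoutian bezoutian_apply bezoutian_isSymm bezoutian_swap bezoutian_smul_left bezoutian_smul_right)

/-! ## §899. Even degree -/

/-- **Even degree: `B_{m+1}(f, X·g) ≻ 0 ∧ B_{m+1}(g, f) ≻ 0 ⟺ f` splits over `ℝ` with simple roots, all negative, and `g(x) f′(x) > 0` at each root `x` of `f`** (`deg f = m + 1`, `lc f > 0`,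
`deg g ≤ m`). [Holtz 2003 Thm 1 (positive-pair reading); this file §899] -/
theorem posDef_bezoutian_pair_iff_of_even (m : ℕ) {f g : ℝ[X]} (hf : f.natDegree = m + 1) (hlc : 0 < f.leadingCoeff) (hg : g.natDegree ≤ m) :
    ((bezoutian (m + 1) f (Polynomial.X * g)).PosDef ∧ (bezoutian (m + 1) g f).PosDef)
      ↔ f.Splits ∧ f.Separable ∧ ∀ x ∈ f.roots, x < 0 ∧ 0 < g.eval x * (derivative f).eval x := by
  have hXg : (-(Polynomial.X * g)).natDegree ≤ m + 1 := by
    rw [natDegree_neg]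
    rcases eq_or_ne g 0 with rfl | hg0
    · simp
    · rw [natDegree_X_mul hg0]; omega
  rw [bezoutian_swap (m + 1) (Polynomial.X * g) f, ← neg_one_smul ℝ (bezoutian (m + 1) (Polynomial.X * g) f), ← bezoutian_smul_left, neg_one_smul,
    posDef_bezoutian_iff_splits_separable_forall_pos hf hlc hXg, posDef_bezoutian_iff_splits_separable_forall_pos hf hlc (by omega)]
  simp only [eval_neg, eval_mul, eval_X]
  constructor
  · rintro ⟨⟨hs, hsep, h1⟩, -, -, h2⟩
    refine ⟨hs, hsep, fun x hx => ⟨?_, h2 x hx⟩⟩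
    have a := h1 x hx
    have b := h2 x hx
    rw [show -(x * g.eval x) * (derivative f).eval x = (-x) * (g.eval x * (derivative f).eval x) by ring] at a
    exact neg_pos.1 ((mul_pos_iff_of_pos_right b).1 a)
  · rintro ⟨hs, hsep, h⟩
    refine ⟨⟨hs, hsep, fun x hx => ?_⟩, hs, hsep, fun x hx => (h x hx).2⟩
    rw [show -(x * g.eval x) * (derivative f).eval x = (-x) * (g.eval x * (derivative f).eval x) by ring]
    exact mul_pos (neg_pos.2 (h x hx).1) (h x hx).2

/-- `lc p = lc f` for `p = f(X²) + X g(X²)` with `deg g < deg f`. [bookkeeping] -/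
theorem leadingCoeff_even_add_odd_of_even {f g : ℝ[X]} (hfg : g.natDegree < f.natDegree) : (expand ℝ 2 f + Polynomial.X * expand ℝ 2 g).leadingCoeff = f.leadingCoeff := by
  have hp := natDegree_even_add_odd_of_lt_left hfg
  rw [leadingCoeff, hp, coeff_even_eq, ← leadingCoeff]

/-- **HERMITE–BIEHLER, EVEN DEGREE `n = 2m + 2` (positive-pair form): for `p = f(X²) + X g(X²)` with `deg f = m + 1`, `deg g ≤ m`, `lc p = lc f > 0`: `p` is a Hurwitz polynomial iff `f`
splits over `ℝ` with simple roots `x`, all negative, with `g(x)·f′(x) > 0`.** [Holtz 2003 Thm 1 (positive-pair reading); this file §899] -/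
theorem forall_re_neg_iff_hermiteBiehler_of_even (m : ℕ) {f g : ℝ[X]} (hf : f.natDegree = m + 1) (hg : g.natDegree ≤ m) (hlc : 0 < f.leadingCoeff) :
    (∀ z ∈ ((expand ℝ 2 f + Polynomial.X * expand ℝ 2 g).map (algebraMap ℝ ℂ)).roots, z.re < 0)
      ↔ f.Splits ∧ f.Separable ∧ ∀ x ∈ f.roots, x < 0 ∧ 0 < g.eval x * (derivative f).eval x := by
  have hp : (expand ℝ 2 f + Polynomial.X * expand ℝ 2 g).natDegree = 2 * m + 2 := by
    rw [natDegree_even_add_odd_of_lt_left (by omega), hf]; ring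
  rw [forall_re_neg_iff_posDef_bezoutian_and_of_even m f g hp, posDef_bezoutian_pair_iff_of_even m hf hlc hg]

/-! ## §900. Odd degree -/

/-- `X·g` splits over `ℝ` with simple roots iff `g` does and `g(0) ≠ 0`. [bookkeeping; this file §900] -/
theorem splits_separable_X_mul_iff {g : ℝ[X]} (hg0 : g ≠ 0) : ((Polynomial.X * g).Splits ∧ (Polynomial.X * g).Separable) ↔ g.Splits ∧ g.Separable ∧ g.coeff 0 ≠ 0 := by
  constructor
  · rintro ⟨hs, hsep⟩
    refine ⟨hs.of_dvd (mul_ne_zero X_ne_zero hg0) (dvd_mul_left g Polynomial.X), hsep.of_mul_right, fun h0 => ?_⟩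
    -- `X² ∣ X g` contradicts separability (squarefreeness)
    obtain ⟨h, hh⟩ := X_dvd_iff.2 h0
    exact Polynomial.not_isUnit_X (hsep.squarefree Polynomial.X ⟨h, by rw [hh]; ring⟩)
  · rintro ⟨hs, hsep, h0⟩
    have hcop : IsCoprime Polynomial.X g := (irreducible_X.coprime_iff_not_dvd).2 fun h => h0 (X_dvd_iff.1 h)
    exact ⟨Splits.X.mul hs, separable_X.mul hsep hcop⟩

/-- `lc p = lc g` for `p = f(X²) + X g(X²)` with `deg f ≤ deg g`, `g ≠ 0`. [bookkeeping] -/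
theorem leadingCoeff_even_add_odd_of_odd {f g : ℝ[X]} (hg0 : g ≠ 0) (hfg : f.natDegree ≤ g.natDegree) : (expand ℝ 2 f + Polynomial.X * expand ℝ 2 g).leadingCoeff = g.leadingCoeff := by
  have hp := natDegree_even_add_odd_of_le_right hg0 hfg
  rw [leadingCoeff, hp, coeff_odd_eq, ← leadingCoeff]

/-- **Odd degree: `B_{m+2}(f, X·g) ≻ 0 ∧ B_{m+1}(g, f) ≻ 0 ⟺ g` splits over `ℝ` with simple roots, all negative, `f(y) g′(y) < 0` at each root `y` of `g`, and `f(0) g(0) > 0`** (`deg g = m + 1`,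
`lc g > 0`, `deg f ≤ m + 1`). [Holtz 2003 Thm 1 + remark in the proof of Thm 2 («p(0)q(0) > 0 … all negative, interlacing»); this file §900] -/
theorem posDef_bezoutian_pair_iff_of_odd (m : ℕ) {f g : ℝ[X]} (hg : g.natDegree = m + 1) (hlc : 0 < g.leadingCoeff) (hf : f.natDegree ≤ m + 1) :
    ((bezoutian (m + 2) f (Polynomial.X * g)).PosDef ∧ (bezoutian (m + 1) g f).PosDef)
      ↔ g.Splits ∧ g.Separable ∧ 0 < f.eval 0 * g.eval 0 ∧ ∀ y ∈ g.roots, y < 0 ∧ f.eval y * (derivative g).eval y < 0 := by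
  have hg0 : g ≠ 0 := leadingCoeff_ne_zero.1 hlc.ne'
  have hXgd : (Polynomial.X * g).natDegree = (m + 1) + 1 := by rw [natDegree_X_mul hg0, hg]
  have hXglc : 0 < (Polynomial.X * g).leadingCoeff := by rw [leadingCoeff_mul, leadingCoeff_X, one_mul]; exact hlc
  have hrootsXg : (Polynomial.X * g).roots = 0 ::ₘ g.roots := by
    rw [roots_mul (mul_ne_zero X_ne_zero hg0), roots_X, Multiset.singleton_add]
  have hder : ∀ y, (derivative (Polynomial.X * g)).eval y = g.eval y + y * (derivative g).eval y := fun y => by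
    rw [derivative_mul, derivative_X, one_mul, eval_add, eval_mul, eval_X]
  rw [bezoutian_swap (m + 1) f g, ← neg_one_smul ℝ (bezoutian (m + 1) f g), ← bezoutian_smul_left, neg_one_smul,
    posDef_bezoutian_iff_splits_separable_forall_pos hXgd hXglc (by omega), posDef_bezoutian_iff_splits_separable_forall_pos hg hlc (by rw [natDegree_neg]; omega)]
  constructor
  · rintro ⟨⟨hsX, hsepX, h1⟩, -, -, h2⟩
    obtain ⟨hs, hsep, -⟩ := (splits_separable_X_mul_iff hg0).1 ⟨hsX, hsepX⟩
    have h10 := h1 0 (by rw [hrootsXg]; exact Multiset.mem_cons_self _ _)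
    rw [hder, zero_mul, add_zero] at h10
    refine ⟨hs, hsep, h10, fun y hy => ?_⟩
    have hgy : g.eval y = 0 := ((mem_roots hg0).1 hy).eq_zero
    have a := h1 y (by rw [hrootsXg]; exact Multiset.mem_cons_of_mem hy)
    have b := h2 y hy
    rw [eval_neg] at b
    rw [hder, hgy, zero_add, show f.eval y * (y * (derivative g).eval y) = (-y) * (-f.eval y * (derivative g).eval y) by ring] at a
    exact ⟨neg_pos.1 ((mul_pos_iff_of_pos_right b).1 a), by linarith⟩
  · rintro ⟨hs, hsep, h0, h⟩
    have h00 : g.coeff 0 ≠ 0 := by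
      intro hz
      rw [coeff_zero_eq_eval_zero] at hz
      rw [hz, mul_zero] at h0
      exact lt_irrefl _ h0
    obtain ⟨hsX, hsepX⟩ := (splits_separable_X_mul_iff hg0).2 ⟨hs, hsep, h00⟩
    refine ⟨⟨hsX, hsepX, fun y hy => ?_⟩, hs, hsep, fun y hy => by rw [eval_neg]; linarith [(h y hy).2]⟩
    rw [hrootsXg, Multiset.mem_cons] at hy
    rw [hder]
    rcases hy with rfl | hy
    · rw [zero_mul, add_zero]; exact h0
    · have hgy : g.eval y = 0 := ((mem_roots hg0).1 hy).eq_zero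
      rw [hgy, zero_add, show f.eval y * (y * (derivative g).eval y) = (-y) * (-f.eval y * (derivative g).eval y) by ring]
      exact mul_pos (neg_pos.2 (h y hy).1) (by linarith [(h y hy).2])

/-- **HERMITE–BIEHLER, ODD DEGREE `n = 2m + 3` (positive-pair form): for `p = f(X²) + X g(X²)` with `deg g = m + 1`, `deg f ≤ m + 1`, `lc p = lc g > 0`: `p` is a Hurwitz polynomial iff `g`
splits over `ℝ` with simple roots `y`, all negative, with `f(y)·g′(y) < 0`, and `f(0)·g(0) > 0`.** [Holtz 2003 Thm 1 (positive-pair reading); this file §900] -/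
theorem forall_re_neg_iff_hermiteBiehler_of_odd (m : ℕ) {f g : ℝ[X]} (hg : g.natDegree = m + 1) (hf : f.natDegree ≤ m + 1) (hlc : 0 < g.leadingCoeff) :
    (∀ z ∈ ((expand ℝ 2 f + Polynomial.X * expand ℝ 2 g).map (algebraMap ℝ ℂ)).roots, z.re < 0)
      ↔ g.Splits ∧ g.Separable ∧ 0 < f.eval 0 * g.eval 0 ∧ ∀ y ∈ g.roots, y < 0 ∧ f.eval y * (derivative g).eval y < 0 := by
  have hg0 : g ≠ 0 := leadingCoeff_ne_zero.1 hlc.ne'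
  have hp : (expand ℝ 2 f + Polynomial.X * expand ℝ 2 g).natDegree = 2 * m + 3 := by
    rw [natDegree_even_add_odd_of_le_right hg0 (by omega), hg]; ring
  rw [forall_re_neg_iff_posDef_bezoutian_and_of_odd m f g hp, posDef_bezoutian_pair_iff_of_odd m hg hlc hf]

end Summit.Ventures.HSemireg.Wedge.HankelOuter
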